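import Mathlib
import Summits.QuantumFields.BalabanUV.T4Continuum.Support.SliceCovariantLevels
import Summits.QuantumFields.BalabanUV.T4Continuum.Support.SliceFlatGaugeDecay

/-!
# T⁴ programme, node NE3 (η-rate of the minimisers) — THE FLAT RUNG, part 6: the stability readings of the lineage's one type
# at `U = 1`, PACKAGED as the `LevIdx`-indexed printed-statement bundles it literally asks for

Fourteenth generation of the NE3 prover lineage P1 of the cell `pub-balaban`, file 6 (bookkeeping; no new estimate).  The one
type `SliceCovariantLevels.ne3Shape_torusCovE_upto_of_printedStatements` (p199789) takes the stability readings as three bundles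
indexed by `LevIdx ι = {(k, V, j) // j ≤ k}`: `hT31 : B9.Thm31Printed … (matrixFamily … (A …))`, `hT349 : B9.Stmt349Printed (d+1) …
(fineKernelOf … (Fk …))` (with `hF3 : Fk k V j 3 U = Ng k V j`), `hT311 : B9.Thm311Printed … (fun p _ _ => (kLevE …).PosDef)`.
THIS FILE instantiates the last two AT THE FLAT DATA of `SliceFlatOperators` (`E := flatE`, `Kc := cubeComb`, `Rm := flatRm`,
`am := flatAm`, `Ng := flatNg`, site distance `:= nbd`), for ANY index type `ι`, ANY backgrounds bundle `Bg` and ANY `c35, M`: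
 * §1 the flat fine-kernel carrier **`flatFk d k N L j`** (`Fk 3 := flatNg j`, `Fk 0 = Fk 1 = Fk 2 := 0` — the one type reads
   only the slot `3`, `hF3`), `flatFk_three` (the binder `hF3` by `rfl`), and **`stmt349Printed_flat`**: `B9.Stmt349Printed (d+1)
   c35 geo Bg (fineKernelOf … (flatFk …))` over `LevIdx ι` — from `SliceFlatGaugeDecay.flatNg_le_349` (gauge half through
   BRIDGE-126 + b05's (1.126); mass-deviation half `SliceFlatMassTerm`) and `ineq349_fineKernelOf_of_entryBounds`; witnesses
   `M₁ = a₀ = 1` and b05-derived `δ₁, C₁` depending on `d` ONLY;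
 * §2 **`thm311Printed_flat`**: `B9.Thm311Printed c35 geo Bg (fun p _ _ => (kLevE flatE cubeComb flatRm wB (aB flatAm) flatNg
   p.1.2.2).PosDef)` — `SliceFlatOperators.posDef_kLevE_flat` ([B5] Prop. 1.1, pv15's `DeltaAR_posDef`) at every index.
WHAT THIS BUYS (honest): two of the three printed-statement hypotheses of the one type are INHABITED, verbatim in its own types, by
Bałaban's `U = 1` objects with constants depending on the dimension only; of `hT31` the item-0 row clause is a theorem
(`SliceFlatOperators.gLevE_flat_rowBound`) but the bundle `B9.Thm31Printed` also carries items 1–3 (`∇G`, `G∇*`, `ΔG` row clauses),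
of which item 1∕2 for the flat family (`hA1`: columns of `G_j·D`) is NOT in the tree — so NO `thm31Printed_flat` is claimed here.
Nothing at `U ≠ 1`, no consistency reading.  NE3 is NOT proved.

Honest framing: finite-T⁴ ultraviolet bookkeeping about MINIMISERS (rung (B)+1 of the cell's ladder); no conditional of the
cell (`BetaPertH`, (B), (B^μ)) is used or hidden; nothing bears on infinite volume, a mass gap, or the Clay problem.  ABSOLUTE
RULE of the cell kept: inputs are kernel-proved tree modules only; `Bg`, `c35`, `M` stay free parameters (the flat bounds hold at
every configuration).  No `sorry`, no axioms beyond Mathlib's.  PLACEMENT (human rule 2026-08-19): cell work under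
`Summits/QuantumFields/BalabanUV/`; imports `Support.SliceCovariantLevels` (p199789) and `Support.SliceFlatGaugeDecay` (p201607);
moves nothing.  Records: `t4/T4-EST-U1b-OSC.md` v1.30 (RESULT 38), `t4/T4-EST-NE3-P1.md` v2.29, GAPS G-ne3p1-44 of the cell
`pub-balaban`.
-/

noncomputable section

open Finset Real Matrix

namespace Summit.QuantumFields.BalabanUV.T4Continuum.SliceFlatReadings

open Literature.MathematicalPhysics.QuantumFieldTheory.Balaban1983to89
open Literature.MathematicalPhysics.QuantumFieldTheory.Balaban1983to89.TreeLengthTorus (TPt)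
open Summit.QuantumFields.BalabanUV.T4Continuum.SliceTorusBlocks
open Summit.QuantumFields.BalabanUV.T4Continuum.SliceTorusBlockModel
open Summit.QuantumFields.BalabanUV.T4Continuum.SliceTorusTower
open Summit.QuantumFields.BalabanUV.T4Continuum.SliceCovariantModel
open Summit.QuantumFields.BalabanUV.T4Continuum.SliceCovariantTower
open Summit.QuantumFields.BalabanUV.T4Continuum.SliceCovariantSkeleton
open Summit.QuantumFields.BalabanUV.T4Continuum.SliceCovariantPrincipal
open Summit.QuantumFields.BalabanUV.T4Continuum.SliceCovariantLevels
open Summit.QuantumFields.BalabanUV.T4Continuum.SliceTorusComb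
open Summit.QuantumFields.BalabanUV.T4Continuum.SliceFlatOperators
open Summit.QuantumFields.BalabanUV.T4Continuum.SliceFlatGaugeDecay

variable (d : ℕ)

/-! ## §1  (3.49) at the flat data, as `B9.Stmt349Printed` over `LevIdx` -/
section Stmt349

/-- **The flat fine-kernel carrier**: the slot `3` (`DPD*`, read by the one type through `hF3`) is the flat remainder form
`flatNg j`; the slots `0, 1, 2` (`P`, `DP`, `PD*`) are not read by the skeleton and are set to `0`. [model] -/
def flatFk (k N L : ℕ) [NeZero N] [NeZero L] (j : ℕ) {B : B9.Backgrounds} :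
    Fin 4 → B.Cfg → Matrix (TPt (d + 1) (N * L ^ k) × Fin (d + 1)) (TPt (d + 1) (N * L ^ k) × Fin (d + 1)) ℝ :=
  fun m _ => if m = 3 then flatNg d k N L j else 0

/-- The binder `hF3` of the one type holds by `rfl` for the flat carrier. [folklore] -/
theorem flatFk_three (k N L : ℕ) [NeZero N] [NeZero L] (j : ℕ) {B : B9.Backgrounds} (U : B.Cfg) :
    flatFk d k N L j 3 U = flatNg d k N L j := rfl

/-- **`hT349` AT THE FLAT DATA — INHABITED.**  For every index type `ι`, every backgrounds bundle and every `c35, M`, the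
printed family statement (3.49) holds for the flat fine-kernel carriers over `LevIdx ι` with the block distance as site
distance: witnesses `M₁ = a₀ = 1` and the `d`-only constants `δ₁, C₁` of `SliceFlatGaugeDecay.flatNg_le_349`. [folklore] -/
theorem stmt349Printed_flat {ι : Type} (N L : ℕ) [NeZero N] [NeZero L] (c35 M : ℝ) (Bg : ℕ → ι → ℕ → B9.Backgrounds) :
    B9.Stmt349Printed (d + 1) c35
      (fun p : LevIdx ι => blockGeom (cubeI (d + 1) p.1.1 N L (Fin (d + 1)) p.1.2.2)
        (fun y y₁ => (nbd (d + 1) p.1.1 N L p.1.2.2 y y₁ : ℝ)) p.1.2.2 (L : ℝ) M)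
      (fun p : LevIdx ι => Bg p.1.1 p.1.2.1 p.1.2.2)
      (fun p : LevIdx ι => fineKernelOf (cubeI (d + 1) p.1.1 N L (Fin (d + 1)) p.1.2.2)
        (fun y y₁ => (nbd (d + 1) p.1.1 N L p.1.2.2 y y₁ : ℝ)) p.1.2.2 (L : ℝ) M
        (flatFk d p.1.1 N L p.1.2.2 (B := Bg p.1.1 p.1.2.1 p.1.2.2))) := by
  obtain ⟨δ₁, C₁, hδ₁, hC₁, h⟩ := flatNg_le_349 d
  have hLpos : (0 : ℝ) < (L : ℝ) := by exact_mod_cast Nat.pos_of_ne_zero (NeZero.ne L)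
  refine ⟨1, δ₁, 1, C₁, one_pos, hδ₁, one_pos, hC₁, fun p _ _ _ _ U _ => ?_⟩
  refine ineq349_fineKernelOf_of_entryBounds _ _ p.1.2.2 M _ U hC₁.le hLpos fun m z w => ?_
  have hLj : (0 : ℝ) < (L : ℝ) ^ p.1.2.2 := pow_pos hLpos _
  by_cases hm : m = 3
  · subst hm
    simpa only [flatFk, if_true, cubeI_apply] using h p.1.1 N L p.1.2.2 p.2 z w
  · simp only [flatFk, if_neg hm, Matrix.zero_apply, abs_zero]
    have hpi : 0 ≤ B9.pref4inv ((L : ℝ) ^ p.1.2.2) m := by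
      fin_cases m <;> simp [B9.pref4inv]
    exact mul_nonneg (mul_nonneg (mul_nonneg hC₁.le hpi) (Real.rpow_nonneg hLj.le _)) (Real.exp_nonneg _)

end Stmt349

/-! ## §2  Theorem 3.11's positivity at the flat data, as `B9.Thm311Printed` over `LevIdx` -/
section Thm311

/-- **`hT311` AT THE FLAT DATA — INHABITED**: the level operators `kLevE flatE cubeComb flatRm wB (aB flatAm) flatNg j` are
positive definite at every index (`SliceFlatOperators.posDef_kLevE_flat` = [B5] Prop. 1.1 ∕ pv15's `DeltaAR_posDef`,
transported), for every `ι`, `Bg`, `geo`, `c35`. [folklore] -/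
theorem thm311Printed_flat {ι : Type} (N L : ℕ) [NeZero N] [NeZero L] (c35 : ℝ) (geo : LevIdx ι → B9.Geometry)
    (Bg : ℕ → ι → ℕ → B9.Backgrounds) :
    B9.Thm311Printed c35 geo (fun p : LevIdx ι => Bg p.1.1 p.1.2.1 p.1.2.2)
      (fun p _ _ => (kLevE (flatE d p.1.1 N L) (cubeComb (d + 1) p.1.1 N L) (flatRm d p.1.1 N L) (wB L (d + 1))
        (aB L (d + 1) flatAm) (flatNg d p.1.1 N L) p.1.2.2).PosDef) := by
  exact ⟨1, 1, one_pos, one_pos, fun p _ _ _ _ _ _ _ => posDef_kLevE_flat d p.1.1 N L p.1.2.2⟩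

end Thm311

end Summit.QuantumFields.BalabanUV.T4Continuum.SliceFlatReadings
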